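import Summits.Ventures.LatticeQCDFlow.Scaling.TwoStageCountFloor

/-!
HONEST FRAMING: exact (Metropolis-corrected) sampling algorithms for lattice gauge theory; figures
of merit are autocorrelation/cost numbers at stated couplings and volumes; no continuum-physics
claim.

# TwoStageSuperSolution — THE EXPLICIT SUPER-SOLUTION OF THE TWO-STAGE RECURSION: WITH `λ = 2hα/β`, PUSH-BACK `β_v ≥ (β/K)(K−v)` AND `2h ≤ β`,
# `G(v,⊥) ≤ (1+u)/(v+1+u)` (`u = 2h/β`), HENCE `P_x{extinct at n} ≤ (1 + 2hα/β)ⁿ·4/(K+2)` FROM `K` PLANTED LABELS AND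
# `t_mix(ε) ≥ (β/(2hα))·log(((K+2)/4)(1−ε−δ))` — THE REFRESH BUDGET'S COUPON COLLECTOR, GENERIC FORM (lean-2 GEN-29, ours)

Venture-side (OURS).  Cell `lqcd-flow` (pub-lqcd), unit `pub-lqcd-lean-2-g29`, 2026-08-28.  Chapter O, file 12: the explicit `G` for
`Scaling/TwoStageCountFloor` (O11), def-free: the sequences are universally quantified with their defining recursions as hypotheses
(`c_v = αv/(λ+αv)`, `ρ_v = h/(h + λ + β_v(1 − c_{v+1}))`, `g_0 = 1`, `g_{v+1} = ρ_v·c_{v+1}·g_v`; `G(v,⊥) = g_v`, `G(v,⊤) = ρ_v g_v`) and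
instantiated inside the final proof.  Equality in both first-step inequalities of O11 holds by construction; with `λ = uα`,
`1 − c_{v+1} = u/(u+v+1)`, and for `β_v ≥ β/2` (true for `2v ≤ K` under `β_v ≥ (β/K)(K−v)`) and `u = 2h/β`, the push-back term is `≥ h/(u+v+1)`,
so `ρ_v ≤ (u+v+1)/(u+v+2)` and the product TELESCOPES: `g_v ≤ (1+u)/(v+1+u)` for `2v ≤ K+2`; by antitonicity `g_K ≤ 4/(K+2)` when `u ≤ 1`.

## What is proved

* `twoStage_c_bounds`, `twoStage_rho_bounds`, `twoStage_superSolution_hyp` — the sequences satisfy O11's hypotheses; `twoStage_rho_le`, `twoStage_g_le`, `twoStage_g_planted_le` — the telescoping.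
* **`twoStage_mixingTime_ge`** — for a chain with the two-stage structure (`α > 0`, `0 < 2h ≤ β`, `β_v ≥ (β/K)(K−v)`), a start with `V(x) = K ≥ 1`,
  `b(x) = ⊥`, `π{¬(V = 0 ∧ ¬b)} ≤ δ`, `ε + δ < 1`, `ε`-close at some time: **`t_mix(ε) ≥ (β/(2hα))·log(((K+2)/4)·(1−ε−δ))`**.

Reading (no numerics implied): for the map-assisted hub `α = t·ĉ·p'·q'/m` (O7), `h = (1−t)w_0`, `β = t·c·K·(p/p')/m` (O13), so
`β/(2hα) = c·K·p/(2ĉ·(1−t)w_0·p'²·q')`: the refresh budget's `log K` with the quality (O14).  NOT CLAIMED: anything measured.  Literature grade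
(cell rule): OWN LEMMA; nothing cited as a fact; no new bib keys.
-/

noncomputable section

open Finset Function
open Literature.Probability.MarkovChains

namespace Summit.Ventures.LatticeQCDFlow.Scaling

/-! ## §1 The sequences and O11's hypotheses -/

section Hyp
variable {α h lam : ℝ} {β : ℕ → ℝ} {c ρ g : ℕ → ℝ} (hα : 0 < α) (hh : 0 < h) (hlam : 0 < lam) (hβ : ∀ v, 0 ≤ β v)
  (hc : ∀ v : ℕ, c v = α * v / (lam + α * v)) (hρ : ∀ v : ℕ, ρ v = h / (h + lam + β v * (1 - c (v + 1))))
  (hg0 : g 0 = 1) (hg : ∀ v : ℕ, g (v + 1) = ρ v * c (v + 1) * g v)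
include hα hlam hc

/-- `0 < c_v ≤ 1` for `v ≥ 1`, `0 ≤ c_v`, and `1 − c_{v+1} = λ/(λ + α(v+1))`. [ours] -/
theorem twoStage_c_bounds (v : ℕ) : 0 ≤ c v ∧ c v ≤ 1 ∧ (1 ≤ v → 0 < c v) ∧ 1 - c (v + 1) = lam / (lam + α * (v + 1 : ℕ)) := by
  have hd : ∀ u : ℕ, (0 : ℝ) < lam + α * u := fun u => by positivity
  refine ⟨by rw [hc]; positivity, by rw [hc, div_le_one (hd v)]; linarith, fun hv => ?_, ?_⟩
  · rw [hc]; have : (0 : ℝ) < v := by exact_mod_cast hv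
    positivity
  · rw [hc]; field_simp; ring

include hh hβ hρ

/-- `0 < ρ_v ≤ 1`. [ours] -/
theorem twoStage_rho_bounds (v : ℕ) : 0 < ρ v ∧ ρ v ≤ 1 := by
  have h1 : 0 ≤ β v * (1 - c (v + 1)) := mul_nonneg (hβ v) (by linarith [(twoStage_c_bounds hα hlam hc (v + 1)).2.1])
  refine ⟨by rw [hρ]; positivity, ?_⟩
  rw [hρ, div_le_one (by positivity)]
  linarith

include hg0 hg

/-- `0 < g_v ≤ 1`. [ours] -/
theorem twoStage_g_bounds (v : ℕ) : 0 < g v ∧ g v ≤ 1 := by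
  induction v with
  | zero => rw [hg0]; exact ⟨one_pos, le_rfl⟩
  | succ v ih =>
    rw [hg]
    have hρb := twoStage_rho_bounds hα hh hlam hβ hc hρ v
    have hcb := twoStage_c_bounds hα hlam hc (v + 1)
    refine ⟨mul_pos (mul_pos hρb.1 (hcb.2.2.1 (by omega))) ih.1, ?_⟩
    calc ρ v * c (v + 1) * g v ≤ 1 * 1 * 1 :=
          mul_le_mul (mul_le_mul hρb.2 hcb.2.1 hcb.1 zero_le_one) ih.2 ih.1.le (by norm_num)
      _ = 1 := by ring

/-- **The sequences satisfy every hypothesis of `twoStage_extinction_le`** for `G(v,⊥) = g_v`, `G(v,⊤) = ρ_v g_v`. [ours] -/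
theorem twoStage_superSolution_hyp {G : ℕ → Bool → ℝ} (hGf : ∀ v, G v false = g v) (hGt : ∀ v, G v true = ρ v * g v) :
    (∀ v b, 0 ≤ G v b) ∧ 1 ≤ G 0 false ∧ (∀ v, G v true ≤ G v false) ∧ (∀ v, G (v + 1) false ≤ G v true)
    ∧ (∀ v : ℕ, 1 ≤ v → α * v * (G (v - 1) true - G v false) ≤ lam * G v false)
    ∧ (∀ v : ℕ, h * (G v false - G v true) - β v * (G v true - G (v + 1) false) ≤ lam * G v true) := by
  have hgpos : ∀ v, 0 < g v := fun v => (twoStage_g_bounds hα hh hlam hβ hc hρ hg0 hg v).1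
  have hρb := twoStage_rho_bounds hα hh hlam hβ hc hρ
  have hcb := twoStage_c_bounds hα hlam hc
  refine ⟨fun v b => ?_, by rw [hGf, hg0], fun v => ?_, fun v => ?_, fun v hv => ?_, fun v => ?_⟩
  · cases b
    · rw [hGf]; exact (hgpos v).le
    · rw [hGt]; exact mul_nonneg (hρb v).1.le (hgpos v).le
  · rw [hGt, hGf]; exact mul_le_of_le_one_left (hgpos v).le (hρb v).2
  · rw [hGf, hGt, hg]
    calc ρ v * c (v + 1) * g v = c (v + 1) * (ρ v * g v) := by ring
      _ ≤ ρ v * g v := mul_le_of_le_one_left (mul_nonneg (hρb v).1.le (hgpos v).le) (hcb (v + 1)).2.1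
  · -- `I0` with equality
    obtain ⟨u, rfl⟩ : ∃ u, v = u + 1 := ⟨v - 1, by omega⟩
    rw [show u + 1 - 1 = u by omega, hGt, hGf, hg]
    set R := ρ u * g u with hR
    have hden : 0 < lam + α * ((u + 1 : ℕ) : ℝ) := by positivity
    have key : α * ((u + 1 : ℕ) : ℝ) * R - α * ((u + 1 : ℕ) : ℝ) * (α * ((u + 1 : ℕ) : ℝ) * R / (lam + α * ((u + 1 : ℕ) : ℝ)))
        = lam * (α * ((u + 1 : ℕ) : ℝ) * R / (lam + α * ((u + 1 : ℕ) : ℝ))) := by field_simp; ring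
    have e1 : ρ u * c (u + 1) * g u = α * ((u + 1 : ℕ) : ℝ) * R / (lam + α * ((u + 1 : ℕ) : ℝ)) := by
      rw [hc, hR]; ring
    rw [e1, mul_sub]
    exact key.le
  · -- `I1` with equality
    rw [hGf, hGt, hGf, hg]
    have h1c : 0 ≤ 1 - c (v + 1) := by linarith [(hcb (v + 1)).2.1]
    have hD : 0 < h + lam + β v * (1 - c (v + 1)) := by
      have := mul_nonneg (hβ v) h1c; positivity
    have key : h * (1 - ρ v) - β v * (ρ v * (1 - c (v + 1))) = lam * ρ v := by
      rw [hρ]; field_simp; ring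
    have e : h * (g v - ρ v * g v) - β v * (ρ v * g v - ρ v * c (v + 1) * g v)
        = (h * (1 - ρ v) - β v * (ρ v * (1 - c (v + 1)))) * g v := by ring
    rw [e, key]
    exact (mul_assoc _ _ _).le

end Hyp

/-! ## §2 The telescoping bound under linear push-back -/

section Telescoping
variable {α h β0 : ℝ} {β : ℕ → ℝ} {K : ℕ} {c ρ g : ℕ → ℝ} (hα : 0 < α) (hh : 0 < h) (hβ0 : 2 * h ≤ β0) (hβ : ∀ v, 0 ≤ β v)
  (hβlin : ∀ v : ℕ, v ≤ K → β0 / K * ((K : ℝ) - v) ≤ β v) (hK : 1 ≤ K)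
  (hc : ∀ v : ℕ, c v = α * v / (2 * h * α / β0 + α * v)) (hρ : ∀ v : ℕ, ρ v = h / (h + 2 * h * α / β0 + β v * (1 - c (v + 1))))
  (hg0 : g 0 = 1) (hg : ∀ v : ℕ, g (v + 1) = ρ v * c (v + 1) * g v)
include hα hh hβ0 hβ hβlin hK hc hρ

/-- With `λ = 2hα/β` and `u = 2h/β`: `ρ_v ≤ (v+1+u)/(v+2+u)` for `2v ≤ K`. [ours] -/
theorem twoStage_rho_le (v : ℕ) (hv : 2 * v ≤ K) : ρ v ≤ ((v : ℝ) + 1 + 2 * h / β0) / ((v : ℝ) + 2 + 2 * h / β0) := by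
  have hβ0pos : 0 < β0 := by linarith
  have hKpos : (0 : ℝ) < K := Nat.cast_pos.mpr (by omega)
  set lam := 2 * h * α / β0 with hlam
  set u := 2 * h / β0 with hu
  have hupos : 0 < u := by positivity
  have hlampos : 0 < lam := by positivity
  have h1c : 1 - c (v + 1) = lam / (lam + α * (v + 1 : ℕ)) := (twoStage_c_bounds hα hlampos hc v).2.2.2
  have hβv : β0 / 2 ≤ β v := by
    refine le_trans ?_ (hβlin v (by omega))
    have hvK : 2 * (v : ℝ) ≤ K := by exact_mod_cast hv
    rw [div_mul_eq_mul_div, le_div_iff₀ hKpos]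
    nlinarith
  have hfrac : lam / (lam + α * ((v + 1 : ℕ) : ℝ)) = u / (u + ((v : ℝ) + 1)) := by
    rw [hlam, hu]; push_cast; field_simp
  rw [hρ, h1c, hfrac]
  have hden : 0 < u + ((v : ℝ) + 1) := by positivity
  have hpush : h / (u + ((v : ℝ) + 1)) ≤ β v * (u / (u + ((v : ℝ) + 1))) := by
    rw [mul_div_assoc', div_le_div_iff_of_pos_right hden]
    have : β0 / 2 * u = h := by rw [hu]; field_simp
    nlinarith [mul_le_mul_of_nonneg_right hβv hupos.le]
  have hX0 : 0 ≤ β v * (u / (u + ((v : ℝ) + 1))) := mul_nonneg (hβ v) (by positivity)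
  rw [div_le_div_iff₀ (by positivity) (by positivity)]
  have key : h * ((v : ℝ) + 2 + u) ≤ (h + h / (u + ((v : ℝ) + 1))) * ((v : ℝ) + 1 + u) := by
    rw [add_mul, div_mul_eq_mul_div, show h * ((v : ℝ) + 1 + u) / (u + ((v : ℝ) + 1)) = h by
      rw [div_eq_iff hden.ne']; ring]
    linarith
  nlinarith [key, mul_le_mul_of_nonneg_right hpush (by positivity : (0 : ℝ) ≤ (v : ℝ) + 1 + u), hlampos.le,
    mul_nonneg hlampos.le (by positivity : (0 : ℝ) ≤ (v : ℝ) + 1 + u)]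

include hg0 hg

/-- **`g_v ≤ (1+u)/(v+1+u)` for `2v ≤ K + 2`** (telescoping). [ours] -/
theorem twoStage_g_le (v : ℕ) (hv : 2 * v ≤ K + 2) : g v ≤ (1 + 2 * h / β0) / ((v : ℝ) + 1 + 2 * h / β0) := by
  have hβ0pos : 0 < β0 := by linarith
  have hlampos : 0 < 2 * h * α / β0 := by positivity
  have hupos : 0 < 2 * h / β0 := by positivity
  induction v with
  | zero => rw [hg0]; simp only [Nat.cast_zero, zero_add]; rw [div_self (by positivity)]
  | succ v ih =>
    rw [hg]
    have h1 := ih (by omega)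
    have hρ' := twoStage_rho_le hα hh hβ0 hβ hβlin hK hc hρ v (by omega)
    have hcb := twoStage_c_bounds hα hlampos hc (v + 1)
    have hρ0 := (twoStage_rho_bounds hα hh hlampos hβ hc hρ v).1.le
    have hgv : 0 ≤ g v := (twoStage_g_bounds hα hh hlampos hβ hc hρ hg0 hg v).1.le
    calc ρ v * c (v + 1) * g v
        ≤ ((v : ℝ) + 1 + 2 * h / β0) / ((v : ℝ) + 2 + 2 * h / β0) * 1 * ((1 + 2 * h / β0) / ((v : ℝ) + 1 + 2 * h / β0)) := by
          exact mul_le_mul (mul_le_mul hρ' hcb.2.1 hcb.1 (by positivity)) h1 hgv (by positivity)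
      _ = (1 + 2 * h / β0) / (((v + 1 : ℕ) : ℝ) + 1 + 2 * h / β0) := by
          have : 0 < (v : ℝ) + 1 + 2 * h / β0 := by positivity
          push_cast; field_simp; ring

/-- **`g_K ≤ 4/(K+2)`.** [ours] -/
theorem twoStage_g_planted_le : g K ≤ 4 / ((K : ℝ) + 2) := by
  have hβ0pos : 0 < β0 := by linarith
  have hlampos : 0 < 2 * h * α / β0 := by positivity
  set u := 2 * h / β0 with hu
  have hupos : 0 < u := by positivity
  have hu1 : u ≤ 1 := by rw [hu, div_le_one hβ0pos]; exact hβ0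
  have hanti : ∀ v w, v ≤ w → g w ≤ g v := by
    intro v w hvw
    induction w with
    | zero => rw [Nat.le_zero.mp hvw]
    | succ w ih =>
      rcases Nat.lt_or_eq_of_le hvw with hlt | heq
      · refine le_trans ?_ (ih (Nat.lt_succ_iff.mp hlt))
        rw [hg]
        have hgw : 0 ≤ g w := (twoStage_g_bounds hα hh hlampos hβ hc hρ hg0 hg w).1.le
        have hcb := twoStage_c_bounds hα hlampos hc (w + 1)
        have h1 : ρ w * c (w + 1) ≤ 1 := mul_le_one₀ (twoStage_rho_bounds hα hh hlampos hβ hc hρ w).2 hcb.1 hcb.2.1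
        exact mul_le_of_le_one_left hgw h1
      · rw [heq]
  refine (hanti (K / 2) K (Nat.div_le_self K 2)).trans ((twoStage_g_le hα hh hβ0 hβ hβlin hK hc hρ hg0 hg (K / 2) (by omega)).trans ?_)
  have ha : ((K : ℝ) + 1) / 2 ≤ ((K / 2 : ℕ) : ℝ) + 1 := by
    have h2 : K ≤ 2 * (K / 2) + 1 := by omega
    have : (K : ℝ) ≤ 2 * ((K / 2 : ℕ) : ℝ) + 1 := by exact_mod_cast h2
    linarith
  rw [div_le_div_iff₀ (by positivity) (by positivity)]
  nlinarith [ha, hu1, hupos]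

end Telescoping

/-! ## §3 The mixing-time floor -/

variable {X : Type*} [Fintype X] [DecidableEq X]

/-- **THE TWO-STAGE `log K` FLOOR (generic):** a row-stochastic `P` with the two-stage structure of O11 for `V, b` with constants `α > 0`, `h > 0`,
push-back `β_v ≥ (β/K)(K−v)` with `2h ≤ β`; a start with `V(x) = K ≥ 1`, `b(x) = ⊥`; `π{¬(V=0 ∧ ¬b)} ≤ δ`, `ε + δ < 1`, `ε`-close at some time:
**`t_mix(ε) ≥ (β/(2hα))·log(((K+2)/4)(1−ε−δ))`**. [ours] -/
theorem twoStage_mixingTime_ge {P : X → X → ℝ} (hP : IsRowStochastic P) (V : X → ℕ) (b : X → Bool)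
    (hS0 : ∀ x y, b x = false → P x y ≠ 0 → V x ≤ V y + 1 ∧ (V y + 1 = V x → b y = true))
    (hS1 : ∀ x y, b x = true → P x y ≠ 0 → V x ≤ V y)
    {α h β0 : ℝ} (hα : 0 < α) (hh : 0 < h) (hβ0 : 2 * h ≤ β0) {β : ℕ → ℝ} (hβ : ∀ v, 0 ≤ β v) {K : ℕ} (hK : 1 ≤ K)
    (hβlin : ∀ v : ℕ, v ≤ K → β0 / K * ((K : ℝ) - v) ≤ β v)
    (hR0 : ∀ x, b x = false → ∑ y ∈ univ.filter (fun y => V y < V x), P x y ≤ α * V x)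
    (hR1 : ∀ x, b x = true → ∑ y ∈ univ.filter (fun y => b y = false ∧ V y = V x), P x y ≤ h)
    (hR2 : ∀ x, b x = true → β (V x) ≤ ∑ y ∈ univ.filter (fun y => V x + 1 ≤ V y), P x y)
    {π : X → ℝ} (hπ1 : ∑ y, π y = 1) {δ : ℝ} (hδ : ∑ y ∈ univ.filter (fun y => ¬(V y = 0 ∧ b y = false)), π y ≤ δ)
    (x : X) (hx : V x = K) (hbx : b x = false) {ε : ℝ} (hεδ : ε + δ < 1) (hmix : ∃ n, worstTvDist P π n ≤ ε) :
    β0 / (2 * h * α) * Real.log (((K : ℝ) + 2) / 4 * (1 - ε - δ)) ≤ (mixingTime P π ε : ℝ) := by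
  have hβ0pos : 0 < β0 := by linarith
  set lam := 2 * h * α / β0 with hlam
  have hlampos : 0 < lam := by positivity
  -- the explicit sequences
  set c : ℕ → ℝ := fun v => α * v / (lam + α * v) with hcdef
  set ρ : ℕ → ℝ := fun v => h / (h + lam + β v * (1 - c (v + 1))) with hρdef
  set g : ℕ → ℝ := fun v => ∏ j ∈ Finset.range v, ρ j * c (j + 1) with hgdef
  have hc : ∀ v : ℕ, c v = α * v / (lam + α * v) := fun v => rfl
  have hρ : ∀ v : ℕ, ρ v = h / (h + lam + β v * (1 - c (v + 1))) := fun v => rfl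
  have hg0 : g 0 = 1 := by simp [hgdef]
  have hg : ∀ v : ℕ, g (v + 1) = ρ v * c (v + 1) * g v := fun v => by
    simp only [hgdef]; rw [Finset.prod_range_succ]; ring
  obtain ⟨hG0, hG00, hm1, hm2, hI0, hI1⟩ := twoStage_superSolution_hyp hα hh hlampos hβ hc hρ hg0 hg
    (G := fun v b => if b then ρ v * g v else g v) (fun v => rfl) (fun v => rfl)
  obtain ⟨n₀, hn₀⟩ := hmix
  set n := mixingTime P π ε with hn
  have hd : worstTvDist P π n ≤ ε := worstTvDist_mixingTime_le P π hn₀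
  have hfloor := twoStage_worstTvDist_ge hP V b hS0 hS1 hR0 hR1 hR2 hlampos.le (fun v b => if b then ρ v * g v else g v)
    hG0 hG00 hm1 hm2 hI0 hI1 hπ1 hδ x n
  rw [hx, hbx] at hfloor
  simp only [Bool.false_eq_true, ↓reduceIte] at hfloor
  have hGK : g K ≤ 4 / ((K : ℝ) + 2) := twoStage_g_planted_le hα hh hβ0 hβ hβlin hK hc hρ hg0 hg
  have hKpos : (0 : ℝ) < (K : ℝ) + 2 := by positivity
  rcases le_or_gt (((K : ℝ) + 2) / 4 * (1 - ε - δ)) 1 with hsmall | hbig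
  · have hlog : Real.log (((K : ℝ) + 2) / 4 * (1 - ε - δ)) ≤ 0 :=
      Real.log_nonpos (le_of_lt (mul_pos (by positivity) (by linarith))) hsmall
    exact le_trans (mul_nonpos_of_nonneg_of_nonpos (by positivity) hlog) (Nat.cast_nonneg _)
  · have hpos : 0 < ((K : ℝ) + 2) / 4 * (1 - ε - δ) := by linarith
    have hkey : ((K : ℝ) + 2) / 4 * (1 - ε - δ) ≤ (1 + lam) ^ n := by
      have h1 : 1 - ε - δ ≤ (1 + lam) ^ n * g K := by linarith
      have h2 : (1 + lam) ^ n * g K ≤ (1 + lam) ^ n * (4 / ((K : ℝ) + 2)) := mul_le_mul_of_nonneg_left hGK (by positivity)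
      calc ((K : ℝ) + 2) / 4 * (1 - ε - δ) ≤ ((K : ℝ) + 2) / 4 * ((1 + lam) ^ n * (4 / ((K : ℝ) + 2))) :=
            mul_le_mul_of_nonneg_left (h1.trans h2) (by positivity)
        _ = (1 + lam) ^ n := by field_simp
    have hlog : Real.log (((K : ℝ) + 2) / 4 * (1 - ε - δ)) ≤ n * Real.log (1 + lam) := by
      rw [← Real.log_pow]; exact Real.log_le_log hpos hkey
    have hl1 : Real.log (1 + lam) ≤ lam := by
      calc Real.log (1 + lam) ≤ Real.log (Real.exp lam) := Real.log_le_log (by linarith) (by linarith [Real.add_one_le_exp lam])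
        _ = lam := Real.log_exp lam
    have hlogn : Real.log (((K : ℝ) + 2) / 4 * (1 - ε - δ)) ≤ n * lam :=
      hlog.trans (mul_le_mul_of_nonneg_left hl1 (Nat.cast_nonneg n))
    rw [show β0 / (2 * h * α) = 1 / lam by rw [hlam]; field_simp]
    rw [one_div, inv_mul_le_iff₀ hlampos]
    linarith

end Summit.Ventures.LatticeQCDFlow.Scaling

end
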